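import Literature.NumberTheory.Automorphic.HilbertRepSchur
import HarnessLib

/-!
# Multiplicity one versus multiplicity `≤ 1` for unitary representations (proof)

Trunk `AutomorphicAxiomatic` (G19), topic `NumberTheory/Automorphic`; sibling proof file of
`HilbertRepSpectrum`, discharging its named fact
`ContRepresentation.hasMultiplicityOne_iff_multiplicity_le_one`:

*for a unitary representation `π` of a group `G` on a complex Hilbert space `H`, "two unitarily
equivalent topologically irreducible closed subrepresentations coincide" (`HasMultiplicityOne`)
is equivalent to "every irreducible closed subrepresentation `W` has `multiplicity π W ≤ 1`",
the multiplicity counting pairwise orthogonal irreducible closed subrepresentations equivalent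
to `W`* (`hasMultiplicityOne_iff_multiplicity_le_one_holds`).

## The proof

`→`: two members of a pairwise orthogonal family of irreducibles equivalent to `W` are
equivalent to each other (`AreUnitarilyEquivalent.trans`), hence equal, so the family has at
most one member. `←` (Deitmar–Echterhoff, *Principles of Harmonic Analysis* (2014), Cor. 6.1.9
and its proof): let `W ≠ W'` be equivalent irreducibles. If `W' ≤ W` then `W' = W` because `W`
is irreducible and `W' ≠ 0` (`ClosedSubrep.eq_of_le_of_isTopIrreducible`). Otherwise the
compression `T = P_{Wᗮ}|_{W'} : W' → Wᗮ` of the orthogonal projection is a *non-zero*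
intertwiner (`Wᗮ` is invariant because `π` is unitary); `T* T` commutes with the irreducible
unitary representation `W'`, so it is a scalar by Schur's lemma (op. cit. Lemma 6.1.7, in the
tree as `IsTopIrreducible.exists_eq_algebraMap_of_commute`), whence `‖T v‖ = r ‖v‖` with `r > 0`
(`IsTopIrreducible.exists_norm_map_eq_mul`, op. cit. Cor. 6.1.9) and `r⁻¹ T` is an isometric
intertwiner of `W'` onto a closed invariant subspace `W'' ≤ Wᗮ`
(`ClosedSubrep.exists_le_orthogonal_areUnitarilyEquivalent`). Then `W''` is irreducible
(irreducibility is invariant under equivalence, `isTopIrreducible_congr`), equivalent to `W`,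
and orthogonal to `W`, so `{W, W''}` witnesses `multiplicity π W ≥ 2`.

## Design notes

* Nothing in `HilbertRepSpectrum` is restated or modified; consumers holding
  `(h : hasMultiplicityOne_iff_multiplicity_le_one)` are fed
  `hasMultiplicityOne_iff_multiplicity_le_one_holds`.
* The auxiliary constructions (`ClosedSubrep.comapEquiv`, the lattice isomorphism
  `ClosedSubrep.congrEquiv` along an equivalence of representations and `isTopIrreducible_congr`,
  the closed subrepresentation `ClosedSubrep.ofLinearIsometry` spanned by an isometric
  intertwiner) are stated in the generality of `HilbertRepSpectrum` (topological modules over a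
  `Ring`, resp. complex Hilbert spaces) and live in `namespace ContRepresentation` as deliberate
  dot-notation extensions, like the definitions they serve.
* **Overlap with files higher in the import graph (for the librarian).** Two automorphic files
  sitting above `GLnCuspidalSpectrum` already contain special or parallel versions of some
  generic lemmas needed here; they are not imported, to keep this discharge of a
  `HilbertRepSpectrum` fact at the bottom of the `NumberTheory/Automorphic` graph:
  `AutomorphicTwist` has the transport `ClosedSubrep.mapTwisted` / `mapTwistedOrderIso` /
  `isTopIrreducible_iff_of_isTwistedEquivariant` along a *twisted*-equivariant
  `ContinuousLinearEquiv` over a `CommRing` (our `comapEquiv` / `congrEquiv` /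
  `isTopIrreducible_congr` are the untwisted case `c = 1`, for Mathlib's bundled
  `ContRepresentation.Equiv`, over a `Ring`); `HeckeEigenvectorProjection` has
  `ClosedSubrep.restrictLE`, `isTopIrreducible_toContRep_iff` and
  `orthogonalProjectionOnto_map_apply`, whose content is re-derived here only *inside* proofs (a
  local structure in `ClosedSubrep.eq_of_le_of_isTopIrreducible`, a local `have` in
  `ClosedSubrep.exists_le_orthogonal_areUnitarilyEquivalent`) and not exported a second time.
  Moving those generic sections below `HilbertRepSpectrum` would let both sides share one copy.

## References

* A. Deitmar, S. Echterhoff, *Principles of Harmonic Analysis*, 2nd ed., Universitext (2014),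
  Thm. 5.1.6, Lemma 6.1.7, Cor. 6.1.9 [DeitmarEchterhoff2014].
* J. Dixmier, *C\*-algebras*, North-Holland (1977), §5.4, §13.1 [Dixmier1977] (the source
  recorded for the definitions and the named fact in `HilbertRepSpectrum`; the argument
  formalised here follows Deitmar–Echterhoff).
-/

noncomputable section

open scoped InnerProductSpace ContRepresentation
open Topology

namespace ContRepresentation

/-! ### Closed subrepresentations under equivalences and inclusions (topological modules) -/

section TopologicalModule

variable {R G V V' : Type*} [Ring R] [Monoid G] [AddCommGroup V] [TopologicalSpace V]
  [IsTopologicalAddGroup V] [Module R V] [AddCommGroup V'] [TopologicalSpace V']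
  [IsTopologicalAddGroup V'] [Module R V']

namespace ClosedSubrep

/-- Pull-back of a closed subrepresentation of `ρ'` along an equivalence `e : ρ ≃ ρ'` (Mathlib's
bundled `ContRepresentation.Equiv`): the closed invariant subspace `e ⁻¹' W'` (closed as the
preimage of a closed set under the continuous `e`, invariant because `e` intertwines). This is
the untwisted (`c = 1`), `Ring`-general counterpart, phrased for `ContRepresentation.Equiv`, of
the transport `ClosedSubrep.mapTwisted` along a twisted-equivariant `ContinuousLinearEquiv`
(`AutomorphicTwist`, over a `CommRing`, above `GLnCuspidalSpectrum` in the import graph and hence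
not imported here); the two should eventually be unified. [folklore] -/
def comapEquiv {ρ : ContRepresentation R G V} {ρ' : ContRepresentation R G V'} (e : ρ.Equiv ρ')
    (W' : ClosedSubrep ρ') : ClosedSubrep ρ where
  toSubmodule := W'.toSubmodule.comap e.toContinuousLinearEquiv.toContinuousLinearMap
  apply_mem_toSubmodule g v hv := by
    change e (ρ g v) ∈ W'
    have h : e (ρ g v) = ρ' g (e v) := e.toContIntertwiningMap.isIntertwining g v
    rw [h]
    exact W'.apply_mem g hv
  isClosed' := by
    change IsClosed (e.toContinuousLinearEquiv ⁻¹' (W' : Set V'))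
    exact W'.isClosed.preimage e.toContinuousLinearEquiv.continuous

/-- Membership in the pull-back: `v ∈ e⁻¹ W' ↔ e v ∈ W'`. [folklore] -/
@[simp]
theorem mem_comapEquiv {ρ : ContRepresentation R G V} {ρ' : ContRepresentation R G V'}
    (e : ρ.Equiv ρ') (W' : ClosedSubrep ρ') (v : V) : v ∈ W'.comapEquiv e ↔ e v ∈ W' :=
  Iff.rfl

/-- An equivalence of representations `e : ρ ≃ ρ'` induces an isomorphism of the ordered sets
of closed subrepresentations, `W ↦ e(W)` (written as the pull-back along `e⁻¹`), with inverse
the pull-back along `e` (untwisted counterpart of `ClosedSubrep.mapTwistedOrderIso` of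
`AutomorphicTwist`, see `comapEquiv`). [folklore] -/
def congrEquiv {ρ : ContRepresentation R G V} {ρ' : ContRepresentation R G V'} (e : ρ.Equiv ρ') :
    ClosedSubrep ρ ≃o ClosedSubrep ρ' where
  toFun W := W.comapEquiv e.symm
  invFun W' := W'.comapEquiv e
  left_inv W := by
    ext v
    simp
  right_inv W' := by
    ext v
    simp
  map_rel_iff' := by
    intro W₁ W₂
    constructor
    · intro h v hv
      have h' : e v ∈ W₁.comapEquiv e.symm := by simpa using hv
      simpa using h h'
    · intro h v hv
      exact h hv

/-- A non-zero closed subrepresentation `W'` contained in a topologically irreducible closed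
subrepresentation `W` is all of `W`: `W ∩ W'` (the preimage of `W'` under the inclusion `W → V`)
is a closed subrepresentation of `W.toContRep`, hence `0` (impossible, `W' ≠ 0`) or `W`. The tree
already has this cut-down construction as `ClosedSubrep.restrictLE` together with the intrinsic
criterion `ClosedSubrep.isTopIrreducible_toContRep_iff` (`HeckeEigenvectorProjection`, which sits
above `GLnCuspidalSpectrum` and is therefore not imported into this generic file); here the
closed subrepresentation is built locally inside the proof. [folklore] -/
theorem eq_of_le_of_isTopIrreducible [T1Space V] {π : ContRepresentation R G V}
    {W W' : ClosedSubrep π} (hW : W.toContRep.IsTopIrreducible)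
    (hW' : Nontrivial W'.toSubmodule) (hle : W' ≤ W) : W' = W := by
  -- `W ∩ W'` as a closed subrepresentation of `W.toContRep` (cf. `ClosedSubrep.restrictLE`)
  let X : ClosedSubrep W.toContRep :=
    { toSubmodule := W'.toSubmodule.comap W.toSubmodule.subtype
      apply_mem_toSubmodule := fun g v hv => by
        change (π g v : V) ∈ W'
        exact W'.apply_mem g hv
      isClosed' := W'.isClosed.preimage continuous_subtype_val }
  have hX : ∀ v : W.toSubmodule, v ∈ X ↔ (v : V) ∈ W' := fun v => Iff.rfl
  rcases ((isTopIrreducible_iff _).mp hW).2 X with hbot | htop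
  · exfalso
    obtain ⟨v, hv⟩ := exists_ne (0 : W'.toSubmodule)
    have hmem : (⟨(v : V), hle v.2⟩ : W.toSubmodule) ∈ X := (hX _).mpr v.2
    rw [hbot, mem_bot] at hmem
    apply hv
    ext
    simpa using congrArg Subtype.val hmem
  · refine le_antisymm hle fun v hv => ?_
    have hmem : (⟨v, hv⟩ : W.toSubmodule) ∈ X := by
      rw [htop]
      exact mem_top _
    exact (hX _).mp hmem

end ClosedSubrep

/-- Topological irreducibility (`IsSimpleOrder` of the lattice of closed subrepresentations) is
invariant under equivalence of representations, via the order isomorphism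
`ClosedSubrep.congrEquiv` (untwisted counterpart of
`ClosedSubrep.isTopIrreducible_iff_of_isTwistedEquivariant` of `AutomorphicTwist`). [folklore] -/
theorem isTopIrreducible_congr [T1Space V] [T1Space V'] {ρ : ContRepresentation R G V}
    {ρ' : ContRepresentation R G V'} (e : ρ.Equiv ρ') :
    ρ.IsTopIrreducible ↔ ρ'.IsTopIrreducible :=
  (ClosedSubrep.congrEquiv e).isSimpleOrder_iff

end TopologicalModule

/-! ### Unitary equivalence is transitive -/

section Normed

variable {R G V V' V'' : Type*} [Ring R] [Monoid G] [SeminormedAddCommGroup V] [Module R V]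
  [SeminormedAddCommGroup V'] [Module R V'] [SeminormedAddCommGroup V''] [Module R V'']

/-- Unitary equivalence is transitive: compose the isometric equivalences
(Mathlib `ContRepresentation.Equiv.trans`, `Isometry.comp`). [folklore] -/
theorem AreUnitarilyEquivalent.trans {π : ContRepresentation R G V} {σ : ContRepresentation R G V'}
    {τ : ContRepresentation R G V''} (h₁ : AreUnitarilyEquivalent π σ)
    (h₂ : AreUnitarilyEquivalent σ τ) : AreUnitarilyEquivalent π τ := by
  obtain ⟨e₁, he₁⟩ := h₁
  obtain ⟨e₂, he₂⟩ := h₂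
  exact ⟨e₁.trans e₂, he₂.comp he₁⟩

end Normed

/-! ### Unitary representations: intertwiners out of irreducibles -/

section Hilbert

variable {G H E E' : Type*} [Group G]
  [NormedAddCommGroup H] [InnerProductSpace ℂ H] [CompleteSpace H]
  [NormedAddCommGroup E] [InnerProductSpace ℂ E] [CompleteSpace E]
  [NormedAddCommGroup E'] [InnerProductSpace ℂ E'] [CompleteSpace E']

/-- A closed subrepresentation of a unitary representation is unitary: each restricted operator
is an invertible isometry (Mathlib `IsUnit.mem_unitary_of_star_mul_self`,
`ContinuousLinearMap.norm_map_iff_adjoint_comp_self`). The same statement is proved, in a leaf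
file above this one, as `Literature.NumberTheory.Automorphic.ClosedSubrep.isUnitary_toContRep`
(`UnramifiedHeckeScalarsFlathProofs`); it is restated here, below it in the import graph, for
the generic theory. [folklore] -/
theorem IsUnitary.toContRep {π : ContRepresentation ℂ G H} (hπ : π.IsUnitary)
    (W : ClosedSubrep π) : W.toContRep.IsUnitary := by
  intro g
  have hu : IsUnit (W.toContRep g) := (Group.isUnit g).map W.toContRep.toMonoidHom
  refine hu.mem_unitary_of_star_mul_self
    ((W.toContRep g).norm_map_iff_adjoint_comp_self.mp fun x => ?_)
  change ‖(π g x : H)‖ = ‖(x : H)‖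
  exact hπ.norm_map g x

/-- The adjoint of an intertwiner `T : ρ₁ → ρ₂` between unitary representations is an
intertwiner `ρ₂ → ρ₁` (Deitmar–Echterhoff (2014), proof of Cor. 6.1.9:
`⟨v, T* ρ₂(g) w⟩ = ⟨ρ₂(g⁻¹) T v, w⟩ = ⟨T ρ₁(g⁻¹) v, w⟩ = ⟨v, ρ₁(g) T* w⟩`).
[cite: DeitmarEchterhoff2014, Cor. 6.1.9] -/
theorem IsUnitary.adjoint_comp_eq {ρ₁ : ContRepresentation ℂ G E} {ρ₂ : ContRepresentation ℂ G E'}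
    (h₁ : ρ₁.IsUnitary) (h₂ : ρ₂.IsUnitary) {T : E →L[ℂ] E'}
    (hT : ∀ g : G, T ∘L ρ₁ g = ρ₂ g ∘L T) (g : G) :
    ContinuousLinearMap.adjoint T ∘L ρ₂ g = ρ₁ g ∘L ContinuousLinearMap.adjoint T := by
  have h := congrArg ContinuousLinearMap.adjoint (hT g⁻¹)
  rw [ContinuousLinearMap.adjoint_comp, ContinuousLinearMap.adjoint_comp, h₁.adjoint_apply,
    h₂.adjoint_apply, inv_inv] at h
  exact h.symm

/-- **Intertwiners out of an irreducible unitary representation are multiples of isometries**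
(Deitmar–Echterhoff (2014), Cor. 6.1.9 and its proof): if `ρ₁` is topologically irreducible and
unitary, `ρ₂` is unitary and `T : ρ₁ → ρ₂` is a bounded intertwiner, then `T* T` commutes with
`ρ₁`, hence is a scalar `λ` by Schur's lemma (op. cit. Lemma 6.1.7), and
`‖T v‖² = ⟨T* T v, v⟩ = λ ‖v‖²`; so `‖T v‖ = r ‖v‖` for the constant `r = √λ ≥ 0`.
[cite: DeitmarEchterhoff2014, Cor. 6.1.9] -/
theorem IsTopIrreducible.exists_norm_map_eq_mul {ρ₁ : ContRepresentation ℂ G E}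
    {ρ₂ : ContRepresentation ℂ G E'} (hirr : ρ₁.IsTopIrreducible) (h₁ : ρ₁.IsUnitary)
    (h₂ : ρ₂.IsUnitary) {T : E →L[ℂ] E'} (hT : ∀ g : G, T ∘L ρ₁ g = ρ₂ g ∘L T) :
    ∃ r : ℝ, 0 ≤ r ∧ ∀ v : E, ‖T v‖ = r * ‖v‖ := by
  set S : E →L[ℂ] E := ContinuousLinearMap.adjoint T ∘L T with hS
  have hcomm : ∀ g : G, Commute (ρ₁ g) S := by
    intro g
    change ρ₁ g ∘L S = S ∘L ρ₁ g
    rw [hS, ← ContinuousLinearMap.comp_assoc, ← h₁.adjoint_comp_eq h₂ hT g,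
      ContinuousLinearMap.comp_assoc, ← hT g, ContinuousLinearMap.comp_assoc]
  obtain ⟨c, hc⟩ := hirr.exists_eq_algebraMap_of_commute h₁ hcomm
  have hsq : ∀ v : E, ‖T v‖ ^ 2 = c.re * ‖v‖ ^ 2 := by
    intro v
    rw [ContinuousLinearMap.apply_norm_sq_eq_inner_adjoint_left, ← hS, hc,
      ContinuousLinearMap.algebraMap_apply, inner_smul_left, RCLike.mul_re, inner_self_im,
      mul_zero, sub_zero, inner_self_eq_norm_sq, RCLike.conj_re, RCLike.re_to_complex]
  refine ⟨Real.sqrt c.re, Real.sqrt_nonneg _, fun v => ?_⟩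
  rw [← Real.sqrt_sq (norm_nonneg (T v)), hsq v, Real.sqrt_mul' _ (sq_nonneg _),
    Real.sqrt_sq (norm_nonneg v)]

/-- The closed subrepresentation of `π` spanned by an isometric intertwiner `U : σ → π`: its
range `U(E)`, closed because `U` is an isometry of a complete space
(Mathlib `Isometry.isClosedEmbedding`), invariant because `π g (U v) = U (σ g v)`. [folklore] -/
def ClosedSubrep.ofLinearIsometry {σ : ContRepresentation ℂ G E} {π : ContRepresentation ℂ G H}
    (U : E →ₗᵢ[ℂ] H) (hU : ∀ (g : G) (v : E), U (σ g v) = π g (U v)) : ClosedSubrep π where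
  toSubmodule := LinearMap.range U.toLinearMap
  apply_mem_toSubmodule g v hv := by
    obtain ⟨w, rfl⟩ := hv
    exact ⟨σ g w, hU g w⟩
  isClosed' := by
    change IsClosed (Set.range U)
    exact U.isometry.isClosedEmbedding.isClosed_range

omit [CompleteSpace H] in
/-- Membership in `ClosedSubrep.ofLinearIsometry U hU`: being a value of `U`. [folklore] -/
theorem ClosedSubrep.mem_ofLinearIsometry {σ : ContRepresentation ℂ G E}
    {π : ContRepresentation ℂ G H} (U : E →ₗᵢ[ℂ] H)
    (hU : ∀ (g : G) (v : E), U (σ g v) = π g (U v)) (x : H) :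
    x ∈ ClosedSubrep.ofLinearIsometry U hU ↔ ∃ v, U v = x :=
  Iff.rfl

/-- An isometric intertwiner `U : σ → π` is a unitary equivalence of `σ` onto the closed
subrepresentation `U(E)` of `π` (Mathlib `LinearIsometry.equivRange`). [folklore] -/
def ClosedSubrep.equivOfLinearIsometry {σ : ContRepresentation ℂ G E}
    {π : ContRepresentation ℂ G H} (U : E →ₗᵢ[ℂ] H)
    (hU : ∀ (g : G) (v : E), U (σ g v) = π g (U v)) :
    σ.Equiv (ClosedSubrep.ofLinearIsometry U hU).toContRep :=
  Equiv.mk U.equivRange.toContinuousLinearEquiv fun g => by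
    apply ContinuousLinearMap.ext
    intro v
    apply Subtype.ext
    change U (σ g v) = π g (U v)
    exact hU g v

omit [CompleteSpace H] in
/-- The equivalence `ClosedSubrep.equivOfLinearIsometry U hU` acts by `U`. [folklore] -/
@[simp]
theorem ClosedSubrep.coe_equivOfLinearIsometry_apply {σ : ContRepresentation ℂ G E}
    {π : ContRepresentation ℂ G H} (U : E →ₗᵢ[ℂ] H)
    (hU : ∀ (g : G) (v : E), U (σ g v) = π g (U v)) (v : E) :
    (ClosedSubrep.equivOfLinearIsometry U hU v : H) = U v :=
  rfl

/-- **The isometric part of a compressed projection** (Deitmar–Echterhoff (2014), Cor. 6.1.9,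
applied as in Dixmier (1977), §5.4): let `π` be unitary, `W` a closed subrepresentation and `W'`
a topologically irreducible closed subrepresentation *not* contained in `W`. Then the
compression `T = P_{Wᗮ}|_{W'} : W' → Wᗮ` of the orthogonal projection is a non-zero intertwiner,
`‖T v‖ = r ‖v‖` with `r > 0` (`IsTopIrreducible.exists_norm_map_eq_mul`), and `r⁻¹ T` is an
isometric intertwiner of `W'` onto a closed subrepresentation `W'' ≤ Wᗮ`; in particular `W'` is
unitarily equivalent to some `W'' ≤ Wᗮ`. [cite: DeitmarEchterhoff2014, Cor. 6.1.9] -/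
theorem ClosedSubrep.exists_le_orthogonal_areUnitarilyEquivalent {π : ContRepresentation ℂ G H}
    (hπ : π.IsUnitary) (W W' : ClosedSubrep π) (hW' : W'.toContRep.IsTopIrreducible)
    (hle : ¬ W' ≤ W) :
    ∃ W'' : ClosedSubrep π, W'' ≤ W.orthogonal hπ ∧
      AreUnitarilyEquivalent W'.toContRep W''.toContRep := by
  set L : ClosedSubrep π := W.orthogonal hπ with hL
  set T : W'.toSubmodule →L[ℂ] L.toSubmodule :=
    L.toSubmodule.orthogonalProjectionOnto ∘L W'.toSubmodule.subtypeL with hTdef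
  have hTapply : ∀ v : W'.toSubmodule, (T v : H) = L.toSubmodule.starProjection v := fun v => rfl
  -- the orthogonal projection onto the closed invariant subspace `L` commutes with `π g`, both
  -- `L` and `Lᗮ` being invariant (Deitmar–Echterhoff (2014), proof of Thm. 5.1.6; in the tree,
  -- above this file, as `ClosedSubrep.orthogonalProjectionOnto_map_apply` of
  -- `HeckeEigenvectorProjection`)
  have hproj : ∀ (g : G) (x : H),
      L.toSubmodule.starProjection (π g x) = π g (L.toSubmodule.starProjection x) := by
    intro g x
    apply Submodule.eq_starProjection_of_mem_orthogonal
    · exact L.apply_mem g (Submodule.starProjection_apply_mem _ x)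
    · rw [← map_sub]
      exact (L.orthogonal hπ).apply_mem g (Submodule.sub_starProjection_mem_orthogonal x)
  -- hence `T` intertwines `W'` and `Wᗮ`
  have hT : ∀ g : G, T ∘L W'.toContRep g = L.toContRep g ∘L T := by
    intro g
    apply ContinuousLinearMap.ext
    intro v
    apply Subtype.ext
    change L.toSubmodule.starProjection (π g v) = π g (L.toSubmodule.starProjection v)
    exact hproj g v
  -- `T ≠ 0` because `W'` is not contained in `W = Wᗮᗮ`
  have hT0 : ∃ v : W'.toSubmodule, T v ≠ 0 := by
    by_contra h0
    push Not at h0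
    apply hle
    intro v hv
    have h1 : (v : H) ∈ L.toSubmoduleᗮ :=
      Submodule.orthogonalProjectionOnto_eq_zero_iff.mp (h0 ⟨v, hv⟩)
    rw [hL, ClosedSubrep.toSubmodule_orthogonal, Submodule.orthogonal_orthogonal] at h1
    exact h1
  obtain ⟨r, hr0, hr⟩ := hW'.exists_norm_map_eq_mul (hπ.toContRep W') (hπ.toContRep L) hT
  have hrpos : 0 < r := by
    obtain ⟨v, hv⟩ := hT0
    rcases hr0.lt_or_eq with h | h
    · exact h
    · exfalso
      apply hv
      rw [← norm_eq_zero, hr v, ← h, zero_mul]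
  -- the isometry `U = r⁻¹ T : W' → H`
  let U : W'.toSubmodule →ₗᵢ[ℂ] H :=
    { toLinearMap := ((r⁻¹ : ℝ) : ℂ) • ((L.toSubmodule.subtypeL ∘L T : W'.toSubmodule →L[ℂ] H) :
          W'.toSubmodule →ₗ[ℂ] H)
      norm_map' := fun v => by
        change ‖((r⁻¹ : ℝ) : ℂ) • (T v : H)‖ = ‖v‖
        rw [norm_smul, Complex.norm_real, Real.norm_eq_abs, abs_of_nonneg (inv_nonneg.mpr hr0),
          Submodule.norm_coe, hr v, ← mul_assoc, inv_mul_cancel₀ hrpos.ne', one_mul] }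
  have hUapply : ∀ v : W'.toSubmodule, U v = ((r⁻¹ : ℝ) : ℂ) • (T v : H) := fun v => rfl
  have hU : ∀ (g : G) (v : W'.toSubmodule), U (W'.toContRep g v) = π g (U v) := by
    intro g v
    have h := congrArg (fun f : W'.toSubmodule →L[ℂ] L.toSubmodule => (f v : H)) (hT g)
    simp only [ContinuousLinearMap.coe_comp, Function.comp_apply] at h
    rw [hUapply, hUapply, h, map_smul]
    rfl
  refine ⟨ClosedSubrep.ofLinearIsometry U hU, ?_, ?_⟩
  · rintro x ⟨v, rfl⟩
    change U v ∈ L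
    rw [hUapply]
    exact L.toSubmodule.smul_mem _ (T v).2
  · refine ⟨ClosedSubrep.equivOfLinearIsometry U hU, ?_⟩
    refine AddMonoidHomClass.isometry_of_norm _ fun v => ?_
    rw [← U.norm_map v]
    rfl

/-! ### The named fact -/

omit [CompleteSpace H] in
/-- `→` of `hasMultiplicityOne_iff_multiplicity_le_one` (no unitarity needed): under
multiplicity one, two members of a pairwise orthogonal family of irreducible closed
subrepresentations equivalent to `σ` are equivalent to each other
(`AreUnitarilyEquivalent.trans`, `.symm`), hence equal, so such a family has at most one
member. [folklore] -/
theorem HasMultiplicityOne.multiplicity_le_one {H' : Type*} [SeminormedAddCommGroup H']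
    [Module ℂ H'] {π : ContRepresentation ℂ G H} (h : π.HasMultiplicityOne)
    (σ : ContRepresentation ℂ G H') : π.multiplicity σ ≤ 1 := by
  unfold multiplicity
  refine iSup_le fun s => iSup_le fun hs => iSup_le fun _ => ?_
  have hcard : s.card ≤ 1 :=
    Finset.card_le_one.mpr fun a ha b hb =>
      h a b (hs a ha).1 (hs b hb).1 ((hs a ha).2.trans (hs b hb).2.symm)
  exact_mod_cast hcard

/-- **Multiplicity one versus multiplicity `≤ 1`**: discharge of the named fact
`hasMultiplicityOne_iff_multiplicity_le_one` of `HilbertRepSpectrum`. For a unitary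
representation `π` on a complex Hilbert space, two unitarily equivalent topologically
irreducible closed subrepresentations coincide iff every irreducible closed subrepresentation
`W` has `multiplicity π W ≤ 1`. `→` is `HasMultiplicityOne.multiplicity_le_one`; for `←`, if
`W ≠ W'` are equivalent irreducibles, either `W' ≤ W`, and then `W' = W` by irreducibility
(`ClosedSubrep.eq_of_le_of_isTopIrreducible`), or the isometric part of `P_{Wᗮ}|_{W'}`
(`ClosedSubrep.exists_le_orthogonal_areUnitarilyEquivalent`, Deitmar–Echterhoff (2014),
Cor. 6.1.9) produces an irreducible `W'' ≤ Wᗮ` equivalent to `W' ≃ W`, and the orthogonal pair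
`{W, W''}` gives `multiplicity π W ≥ 2` (Dixmier (1977), §5.4).
[cite: DeitmarEchterhoff2014, Cor. 6.1.9] -/
theorem hasMultiplicityOne_iff_multiplicity_le_one_holds :
    hasMultiplicityOne_iff_multiplicity_le_one (G := G) (H := H) := by
  intro π hπ
  classical
  constructor
  · intro h W _
    exact h.multiplicity_le_one W.toContRep
  · intro h W W' hW hW' he
    by_cases hle : W' ≤ W
    · exact (ClosedSubrep.eq_of_le_of_isTopIrreducible hW
        ((isTopIrreducible_iff _).mp hW').1 hle).symm
    · exfalso
      obtain ⟨W'', hW''le, hW''e⟩ :=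
        ClosedSubrep.exists_le_orthogonal_areUnitarilyEquivalent hπ W W' hW' hle
      have hW''W : AreUnitarilyEquivalent W''.toContRep W.toContRep :=
        hW''e.symm.trans he.symm
      obtain ⟨e'', -⟩ := hW''e
      have hW''irr : W''.toContRep.IsTopIrreducible :=
        (isTopIrreducible_congr e'').mp hW'
      have horth : W.toSubmodule ⟂ W''.toSubmodule :=
        (Submodule.isOrtho_orthogonal_right W.toSubmodule).mono_right hW''le
      have hne : W ≠ W'' := by
        intro hWW
        rw [← hWW, Submodule.isOrtho_self] at horth
        have hnt : Nontrivial W.toSubmodule := ((isTopIrreducible_iff _).mp hW).1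
        exact (Submodule.nontrivial_iff_ne_bot.mp hnt) horth
      -- the orthogonal pair `{W, W''}` has multiplicity `≤ 1`
      have hcard : ((({W, W''} : Finset (ClosedSubrep π)).card : ℕ) : ℕ∞) ≤ 1 := by
        refine le_trans ?_ (h W hW)
        unfold multiplicity
        refine le_iSup_of_le {W, W''} (le_iSup_of_le ?_ (le_iSup_of_le ?_ le_rfl))
        · intro X hX
          rw [Finset.mem_insert, Finset.mem_singleton] at hX
          rcases hX with rfl | rfl
          · exact ⟨hW, AreUnitarilyEquivalent.refl _⟩
          · exact ⟨hW''irr, hW''W⟩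
        · rw [Finset.coe_pair, Set.pairwise_pair]
          exact fun _ => ⟨horth, horth.symm⟩
      have hcard' : ({W, W''} : Finset (ClosedSubrep π)).card ≤ 1 := by exact_mod_cast hcard
      exact hne (Finset.card_le_one.mp hcard' W (by simp) W'' (by simp))

end Hilbert

end ContRepresentation
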